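import Literature.NumberTheory.EllipticCurves.GreenbergVatsal2000.IwasawaInvariants
import Literature.NumberTheory.EllipticCurves.YanZhu2026.CyclotomicMainTheoremRational
import HarnessLib

/-!
# Yan–Zhu 2026, Theorem 4.9, second clause: the cyclotomic main theorem in `Λ_ℚ` itself at an ODD
# good ordinary prime with `ρ̄_{E,p}` irreducible, under (Im)

Source: Xiaojun Yan, Xiuwu Zhu, *Main conjectures for non-CM elliptic curves at good ordinary
primes*, J. Algebra **693** (2026), doi:10.1016/j.jalgebra.2026.01.016 (the arXiv record carries
the journal DOI, checked 2026-08-20); read on the store text `paper:arxiv-2412.20078` = arXiv **v2**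
(2025-01-03): §4.4, statement 4.8 and Theorem 4.9; §1.1 display (Im) (bib key
`YanZhu2024MainConjNonCM`, as in the sibling files `YanZhu2026/CyclotomicMainTheoremRational.lean` —
the FIRST clause of Thm. 4.9, which names this second clause as its `-- TODO(general form)` — and
`YanZhu2026/PPartBSD.lean`, Thm. 4.15).

ARXIV-VERSION NOTE (2026-08-23; lit GEN 98 `HOME/b2b-bsdres-lit/g98/DRIFT-READS.md` §F1, GLUE seat
gen 12): the numbers and pages quoted in this file ("§4.4", "p0011", "Thm. 4.9", "Thm. 4.15", "4.8")
are arXiv v2's and were previously labelled "v4". In the CURRENT text arXiv v3 ≡ **v4** (2026-01-23,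
the revision carrying the journal DOI) Theorem 4.9 is **Theorem 5.2** (§5.1; 4.8 = Conj. 5.1), Thm.
4.15 → Thm. 5.11 (§5.3), Thm. 4.7 = Thm. 4.7, Cor. 1.4 = Cor. 1.4, Rem. 1.3 rewritten; the statement
vendored here is UNCHANGED IN CONTENT (v2 "if (Im) holds" → v4 "if condition (Im) holds"; lit GEN
98 diff read: CLEARED, locator drift only), and so is the rank-`0` sentence of the proof of Thm.
4.15 / 5.11 quoted below (v4 TeX l.1345: "follows from the integral part of Theorem 5.2, combined with
descent arguments (see [SU14, Section 3.6.1] for details)").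

HONEST FRAMING (cell `b2b-bsdres`, run/shared/lean/b2b/bsd-rank1-residual/): the cell deletes
COMBINATION-shaped residual classes of the rank-`≤ 1` BSD formula from PUBLISHED theorems only and
types the construction-shaped ones; announced results are OPEN hypotheses; this is not "finishing
BSD". This file vendors ONE refereed theorem as a named fact (`def … : Prop`, D-0014; nothing
asserted, no `_holds`) and proves its rank-`0` consumer. Its use in the cell: the INTEGRAL cyclotomic
main-conjecture input of row C16 of RESIDUAL-CASES §a.1 (`p = 3` good ordinary, (irr),
surj ∨ (ram)) — the companion Burungale–Castella–Skinner fact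
`BurungaleCastellaSkinner2025.thm112b_charIdeal_eq_padicLFunction_integral` (IMRN 2025 Thm. 1.1.2 (b),
GLUE seat gen 2) is printed for `p > 3` only. The statement below is, binder for binder, that BCS
fact with `3 < p` relaxed to `3 ≤ p` — which is exactly what Theorem 4.9 prints ("`p > 2`").

As printed (§4.4, LaTeXML text of arXiv v2, `[corpus: paper:arxiv-2412.20078 p0011 L24–L47]`; = §5.1
Thm. 5.2 of v4): "Let `E/ℚ` be an elliptic curve of conductor `N`, `p > 2` a prime such that `E` has good ordinary
reduction at `p`. Suppose that the residue representation `ρ̄_E : G_ℚ → Aut(E[p])` is irreducible.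
[4.8 (Mazur's statement): `𝒳_{ℱ_ord}(E/ℚ_∞)` is `Λ_ℚ`-torsion and
`Char_{Λ_ℚ}(𝒳_{ℱ_ord}(E/ℚ_∞)) = (𝓛_p^{MSD}(E/ℚ))`.] … Theorem 4.9. `𝒳_{ℱ_ord}(E/ℚ_∞)` is
`Λ_ℚ`-torsion and `Char_{Λ_ℚ}(𝒳_{ℱ_ord}(E/ℚ_∞)) ⊗ ℚ_p = (𝓛_p^{MSD}(E/ℚ))` in `Λ_ℚ ⊗ ℚ_p`.
**Moreover, if (Im) holds, we have `Char_{Λ_ℚ}(𝒳_{ℱ_ord}(E/ℚ_∞)) = (𝓛_p^{MSD}(E/ℚ))` in `Λ_ℚ`.**"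
with (Im) (§1.1, `[p0003 L61–L66]`): "there exists `τ ∈ Gal(ℚ̄/ℚ(μ_{p^∞}))` such that
`T_pE/(ρ_E(τ) − 1)T_pE` is free of `ℤ_p`-rank one". Here (§3.3, Theorem 3.6 (CGS)) `𝓛_p^{MSD}(E/ℚ) ∈ Λ_ℚ`
is the Mazur–Swinnerton-Dyer `p`-adic `L`-function normalised by the Néron period
(`𝓛_p^{MSD}(E/ℚ)(1) = (1 − α_p⁻¹)² · L(E,1)/Ω_E^+`), and `𝒳_{ℱ_ord}(E/ℚ_∞)` is the Pontryagin dual of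
the ordinary (= `p^∞`-) Selmer group over the cyclotomic `ℤ_p`-extension (§2). Printed proof (§4.3–4.4,
`[p0011 L15–L36]`): the two-variable Theorem 4.2 (Skinner–Urban's `GU(2,2)` divisibility + the
Beilinson–Flach equivalence Thm. 4.7 + Hsieh's `μ = 0`) and "similarly to [SU14], by Theorem 4.2 and
descent arguments"; for the integral clause "by using [Kato] and a commutative algebra lemma
([SU14]) … the condition `Im(ρ_E) ⊃ SL₂(ℤ_p)` is used, but it can be replaced by (Im) as discussed in
the last paragraph of [Ski16]". Rem. 1.3: "Burungale–Castella–Skinner proved the rational version …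
assuming `p > 3` and `ρ̄_E` irreducible, and the integral version if (Im) also holds. Their results
don't cover ours, nor do ours cover theirs."

## Hypotheses, enumerated (word for word → tree predicate; the binder list after the four hypotheses on `(E, p)` is copied VERBATIM from `GreenbergVatsal2000.thm13_charIdeal_eq_of_gvPar`)

1. "`E/ℚ` an elliptic curve of conductor `N`" — `W : WeierstrassCurve ℚ`, `[W.IsElliptic]`,
   `[W.IsGloballyMinimal]`; modularity enters through the newform binder `f` at level `N_E`.
2. "`p > 2` a prime such that `E` has good ordinary reduction at `p`" — `3 ≤ p`, `GoodOrd W p`.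
3. "`ρ̄_E` irreducible" (standing assumption of §4.4) — `Irr W p`.
4. (Im) — `BigIm W p` (`Rank1Residual/Predicates.lean`: some `σ ∈ Γ_ℚ` fixing every `p`-power root
   of unity with `T_pE/(σ − 1)T_pE ≃_{ℤ_p} ℤ_p` on `W.tateModule p`; the docstring of `BigIm` cites
   exactly "(Burungale–Castella–Skinner 2025 (im); Yan–Zhu 2026 (Im))").
5.–7. `ℚ_∞`, `Λ_ℚ = ℤ_p⟦T⟧`, the rational `ϖ` with `ϖ · Ω_E = Ω⁺_f` re-normalising the tree's
   `padicLFunction f (unitRoot W p)` to the Néron period, and every dual datum `D`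
   (`𝒳_{ℱ_ord}(E/ℚ_∞)`), conclusion `D.IsTorsion ∧ ∃ g, D.charIdeal = (g) ∧ ι g = ϖ · L_p(f, α)` —
   verbatim as in the GV / CGS / BCS facts (their docstrings justify each atom; at odd `p` the factor
   `c_∞ ∈ {1,2}` between `W.realPeriodRat` and `Ω_E^+` is a unit of `ℤ_p` and the `∃ g` form absorbs
   units).

Cell flag (referee rulings R9.1/R10.1 on the sibling Theorem 4.15, applying verbatim to Theorem 4.9
from which 4.15 is deduced): `YZ26@3-BF-ERL-Ohta` — the Beilinson–Flach equivalence Thm. 4.7 is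
printed "Similarly, as [BSTW] (see also [CGS])" with every proof pointer to the preprint BSTW
arXiv:2409.01350 (still a preprint on 2026-08-20: arXiv API journal_ref/doi none, Crossref no
record); at `p = 3` the `Λ`-adic explicit reciprocity / Eichler–Shimura inputs are in print only for
`p ≥ 5`. The statement is the REFEREED statement, valid as printed at every `p > 2`; the flag concerns
a proof-level input at `p = 3` and is not a claim that anything is false. No `_holds` is to be
expected; consumers take `(hYZ : thm49_charIdeal_eq_padicLFunction_integral)`. This file introduces
exactly ONE named fact; nothing else is minted.

D-AUDIT OF RECORD at `p = 3` (cell `bsd-litref/yz26`, typer seat `bsd-litref-yz26-ty`, 2026-08-26;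
docstring-only addendum, the statement below is byte-identical to p241401; full text of the reading
in the sibling `YanZhu2026/PPartBSD.lean`, section "v4 READING OF RECORD"). Reader sheets (two,
independent, concurring) `run/shared/lean/pub/bsd-litref/yz26/sheets/D-AUDIT-yz26-r1.md` (sha16
`afcaff78c72f86dd`) and `…/D-AUDIT-T2c-yz26-r2.md` (sha16 `156794b7540493ec`), both SEALED, with
post-seal ADDENDA-1 `…/D-AUDIT-yz26-r1-ADDENDUM-1.md` (sha16 `ed8bed88180f8d5e`) and
`…/D-AUDIT-T2c-yz26-r2-ADDENDUM-1.md` (sha16 `2075b9099f88ace7`) (concordance; gap width settled at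
the page: `Λ_D`-projectivity/control is refereed print at every `p` by Hida, *Elementary Modular
Iwasawa Theory* (2022) Thm. 4.2.37 and the `Λ_D`-pairing is formal given it — the residual is exactly
the `Λ`-adic Eichler–Shimura package at `(3, ω⁰)` and `(3, ω⁻¹)`; every D3 class is surj(3)); all
filed to the D-audit desk (referee C2 =
pub-bsdpct-r4, from 2026-08-26T19:22Z referee C = pub-bsdpct-r3); referee C's ruling: R361 (2026-08-26T21:22:43Z, yz26 group ruling, all four wakes): «STATEMENT VERBATIM ×2 CONCUR (desk
PC/NC conforming); HYPOTHESES MET with both addenda sharpenings ADOPTED; PROOF INPUTS AT 3: GAP(BSTW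
p0029:L7) CONFIRMED at ONE node with TWO prongs G♯ ∧ G♭ — both prongs re-found at this desk on its own pages;
flag re-wording GRANTED (two-prong); row D3 stays LITERAL, 0 of 4 814 cells move» (R361.3 (γ): width
resolution ADOPTED — the gap is EXACTLY the ES rows; (δ) T0 BY NAME; (ε) register-wide prong map + strike test
for referee A; two-prong string of record in `YanZhu2026/PPartBSD.lean`, "Cell flag" paragraph);
referee A: not seized of any move — GAP(line) ⇒ 0 move; the record note (re-wording + prong map + acq-11255 correction + p454928) is the lead's PRICING-D3-YZ26-v1 (sha16 8dbaebf5a815cdf8) filed to A 2026-08-26T21:25Z, round pending (cell lead rulings 21:02:36Z / 21:25:52Z). The readers' finding, two independent and concurring: the flagged input of Thm. 5.2 (= v2 Thm. 4.9, this fact) is the Beilinson–Flach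
equivalence Thm. 4.7, v4 TeX l.1022–1034: "essentially [BSTW, Proposition 9.18] … building on
explicit reciprocity laws for the Beilinson-Flach classes and global Poitou-Tate duality" — its LOGIC
(BSTW II Prop. 1.18; refereed twin Castella–Grossi–Skinner, Math. Ann. 393 (2025) Prop. 4.2.1)
PASSES in cell; its explicit reciprocity laws (BSTW I Thms. 4.5/4.7 ⇐ KLZ17 Thm. B) rest at `p = 3`
on the Ohta–Hida `Λ_D`-adic package BSTW Thm. 3.1–3.2 (= KLZ17 Prop. 7.2.1 / Thm. 7.2.3 / Thm. 9.5.1–2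
/ Prop. 10.1.1), printed for `p ≥ 5` only (KLZ17 §7.2; Ohta 1995/1999 `p ≥ 5` and `e′ = ⊕_{i≢0,−1}`;
Ohta 2000; Fukaya–Kato, Kyoto J. Math. 64 (2024) §0.26) and sourced at `p = 3` by BSTW's sentence
arXiv:2409.01350v2 p. 29 ("The arguments in these papers likely apply to the `p = 3` case as well. The
results of [Ca] explicitly covers some parts of the `p = 3` cases. An alternate proof that also
includes the `p = 3` case is included in [SV-S-Ohta]") — **GAP(BSTW p0029:L7)** with TWO prongs:
(G1 = r2's G♯) the Hida family through `f_E^α` lies at `p = 3` on the TRIVIAL `μ₂`-component of `ℤ₃⟦ℤ₃^×⟧`,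
excluded by Cais, Compositio 154 (2018) (`e*′`) and by Ohta 1995/1999 — no printed source at `3`;
(G2 = r2's G♭) the CM family `𝐡_v` (component `ω^{−1}`, inside `e*′`) is residually Eisenstein and needs the
open-curve row of BSTW Thm. 3.1 (ii) — Cais covers the closed-curve `e*′` statements only; the rest is
[SV-S-Ohta] (Sangiovanni Vincentelli–Skinner, unpublished and publicly unlocated on 2026-08-26).
This two-prong text SUPERSEDES the one-line `p = 3` clause of the "Cell flag" paragraph above. Not
DISPUTED; statement-level grade unchanged; typed target of record for the gap, by NAME (the
`Λ`-adic modular-forms tower is below tree vocabulary): `MazurMainConjecture W 3`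
(`Summit.BirchSwinnertonDyer.BirchSwinnertonDyer.Theorems.Rank1ResidualX1Defs`, `@[conjecture]`),
whose row-C16 consumer `RowC16.bsdp_rankZero_of_mazurMainConjecture` is PROVED.

## References

* X. Yan, X. Zhu, J. Algebra 693 (2026); numbers as read in arXiv:2412.20078v2 (= v4: Thm. 4.9 → 5.2,
  Thm. 4.15 → 5.11, ARXIV-VERSION NOTE): §4.4 (4.8), Thm. 4.9; §1.1 (Im), Rem. 1.3, Cor. 1.4; §4.6
  Thm. 4.15 and its proof ("The rank `0` `p`-part BSD formula comes from (the
  integral part of) Theorem (cyc) and descent arguments (see [SU14] for details)").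
* A. Burungale, F. Castella, C. Skinner, IMRN 2025 (arXiv:2405.00270v2), Thm. 1.1.2 (b) (the `p > 3`
  companion, tree fact `BurungaleCastellaSkinner2025.thm112b_charIdeal_eq_padicLFunction_integral`).
* R. Greenberg, V. Vatsal, Invent. Math. 142 (2000), Thm. (1.3) — binder list reused verbatim.
* R. Greenberg, LNM 1716 (1999), Thm. 4.1 — the `hGr` input of the rank-`0` glue.
-/

set_option autoImplicit false

noncomputable section

open scoped Classical MatrixGroups ModularForm

open CongruenceSubgroup WeierstrassCurve Literature.NumberTheory.EllipticCurves
  Literature.NumberTheory.EllipticCurves.ModularForms Literature.NumberTheory.EllipticCurves.Rank1Residual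

namespace Literature.NumberTheory.EllipticCurves.YanZhu2026

/-- **Yan–Zhu, J. Algebra 693 (2026), Theorem 4.9 of arXiv:2412.20078v2 (= Theorem 5.2, §5.1 of v4
= the journal numbering; ARXIV-VERSION NOTE in the module docstring), second clause (§4.4)**:
"Let `E/ℚ` be an elliptic curve of conductor `N`, `p > 2` a prime such that `E` has good ordinary
reduction at `p`. Suppose that the residue representation `ρ̄_E : G_ℚ → Aut(E[p])` is irreducible. …
Theorem 4.9. `𝒳_{ℱ_ord}(E/ℚ_∞)` is `Λ_ℚ`-torsion and `Char_{Λ_ℚ}(𝒳_{ℱ_ord}(E/ℚ_∞)) ⊗ ℚ_p =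
(𝓛_p^{MSD}(E/ℚ))` in `Λ_ℚ ⊗ ℚ_p`. Moreover, if (Im) holds, we have
`Char_{Λ_ℚ}(𝒳_{ℱ_ord}(E/ℚ_∞)) = (𝓛_p^{MSD}(E/ℚ))` in `Λ_ℚ`" — with (Im) (§1.1): "there exists
`τ ∈ Gal(ℚ̄/ℚ(μ_{p^∞}))` such that `T_pE/(ρ_E(τ) − 1)T_pE` is free of `ℤ_p`-rank one".
Transcription (module docstring items 1–7): `3 ≤ p`, `GoodOrd W p`, `Irr W p`, `BigIm W p` (Im);
everything after them VERBATIM as in `GreenbergVatsal2000.thm13_charIdeal_eq_of_gvPar`: for the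
cyclotomic `ℤ_p`-extension `κ`, a topological generator `γ` matching the cyclotomic variable, the
newform `f` of `E` at level `N_E`, the rational `ϖ` with `ϖ · Ω_E = Ω⁺_f` (so that `ϖ · L_p(f, α)`
is `𝓛_p^{MSD}(E/ℚ)` for the model's real period) and every dual datum `D`: `D` is `Λ`-torsion and
`char_Λ D = (g)` with `ι g = ϖ · L_p(f, α)`, `α = unitRoot W p` — the body of the cell's typed (MC)
input predicate of `Summits/…/Theorems/Rank1ResidualX1Defs.lean` and the spelling of the hypothesis
`hMC` of the tree's rank-`0` glue theorem of `LeadingTermPPartEisensteinProofs`. The first clause is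
the sibling fact `thm49_charIdeal_eq_padicLFunction`; for `p > 3` this clause is also
Burungale–Castella–Skinner 2025 Thm. 1.1.2 (b). REFEREED; cell documentation flag
`YZ26@3-BF-ERL-Ohta` (module docstring) on a proof-level input at `p = 3`.
[cite: YanZhu2024MainConjNonCM, Thm. 4.9 second clause (§4.4, p. 11 of arXiv:2412.20078v2; = Thm. 5.2, §5.1 of v4 = J. Algebra 693 (2026)), with (4.8) (v4 Conj. 5.1) and display (Im) (§1.1)]
[cite: GreenbergVatsal2000, Thm. (1.3) (binder list of the tree transcription reused verbatim)] -/
def thm49_charIdeal_eq_padicLFunction_integral : Prop :=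
  ∀ (W : WeierstrassCurve ℚ) [W.IsElliptic] [W.IsGloballyMinimal] (p : ℕ) [Fact p.Prime],
    3 ≤ p → GoodOrd W p → Irr W p → BigIm W p →
    ∀ (κ : ZpExtension ℚ p) (γ : Field.absoluteGaloisGroup ℚ),
        κ.IsCyclotomic → κ.IsTopGenerator γ → IsCyclotomicVariable p γ →
      ∀ [NeZero (W.conductorNorm ℤ)] (f : CuspForm (Gamma0 (W.conductorNorm ℤ)) 2),
        IsNewformOf W f → ∀ (ϖ : ℚ), (ϖ : ℝ) * W.realPeriodRat = plusPeriod f →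
      ∀ (D : W.SelmerDualData κ γ), D.IsTorsion ∧
        ∃ g : IwasawaAlgebra p, D.charIdeal = Ideal.span {g} ∧
          iwasawaToPowerSeries p g =
            PowerSeries.C (ϖ : ℚ_[p]) * padicLFunction f (unitRoot W p : ℚ_[p])

/-- **Theorem 4.9 (second clause) ⇒ the rank-`0` print shape** (the `r = 0` half of Yan–Zhu
Thm. 4.15, re-assembled in the kernel from its printed pieces — "The rank `0` `p`-part BSD formula
comes from (the integral part of) Theorem (cyc) and descent arguments (see [SU14] for details)",
§4.6): for `W/ℚ` globally minimal elliptic, `p ≥ 3` good ordinary with `E[p]` irreducible and (Im),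
and `L(E,1) ≠ 0`, the rank-`0` shape `PPartRankZero W p`
(`ord_p(L(E,1)/Ω_E) = ord_p #Ш + ord_p ∏c_ℓ − 2 ord_p #E(ℚ)_tors`) follows from the fact (`hYZ`),
Greenberg's Thm. 4.1 (`hGr`, inline exactly as in `GreenbergVatsal2000.pPartRankZero_of_gvPar`; valid
at every odd `p`), modularity (`hmod`) and Gross–Zagier–Kolyvagin (`hGZK`), through the tree glue
`padicValRat_bsd_rank_zero_of_mazurMainConjecture`. [cite: YanZhu2024MainConjNonCM, Thm. 4.15 (r = 0) and its proof (§4.6 of arXiv v2; = Thm. 5.11, §5.3 of v4), from Thm. 4.9 (v4 Thm. 5.2)]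
[cite: GreenbergLNM1716, Thm. 4.1 (the shape of `hGr`)] [cite: SkinnerUrban2014, proof of Thm. 3.6.11 (p. 46) (the descent)] -/
theorem pPartRankZero_of_thm49_integral (hYZ : thm49_charIdeal_eq_padicLFunction_integral)
    (hmod : nonempty_modularParametrizationData)
    (hGZK : rank_eq_analyticRank_of_analyticRank_le_one)
    (W : WeierstrassCurve ℚ) [W.IsElliptic] [W.IsGloballyMinimal] (p : ℕ) [Fact p.Prime]
    (hp : 3 ≤ p) (hord : GoodOrd W p) (hirr : Irr W p) (him : BigIm W p)
    (hL : W.entireLFunction 1 ≠ 0)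
    (hGr : ∀ (κ : ZpExtension ℚ p) (γ : Field.absoluteGaloisGroup ℚ),
        κ.IsCyclotomic → κ.IsTopGenerator γ → IsCyclotomicVariable p γ →
      ∀ (D : W.SelmerDualData κ γ) [Module.Finite (IwasawaAlgebra p) D.X], D.IsTorsion →
      ∀ (fE : IwasawaAlgebra p), D.charIdeal = Ideal.span {fE} →
        Finite (W.selmerGroupPInfty p) →
        ∃ u : ℤ_[p]ˣ,
          ((PowerSeries.constantCoeff fE : ℤ_[p]) : ℚ_[p]) *
              (Nat.card (AddCommGroup.primaryComponent W.toAffine.Point p) : ℚ_[p]) ^ 2 =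
            ((u : ℤ_[p]) : ℚ_[p]) * (p : ℚ_[p]) ^ (padicValNat p W.tamagawaProduct) *
              (Nat.card (AddCommGroup.primaryComponent
                ((integralModelInt W).map (Int.castRingHom (ZMod p))).toAffine.Point p) : ℚ_[p]) ^ 2 *
              (Nat.card (W.selmerGroupPInfty p) : ℚ_[p])) :
    PPartRankZero W p := by
  have hr : W.analyticRank = 0 :=
    Literature.NumberTheory.EllipticCurves.analyticRank_eq_zero_of_entireLFunction_one_ne_zero W hL
  obtain ⟨-, hfin⟩ := hGZK W (by omega)
  exact padicValRat_bsd_rank_zero_of_mazurMainConjecture W p hord.1 hord.2 hL hfin hmod hGr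
    (hYZ W p hp hord hirr him)

end Literature.NumberTheory.EllipticCurves.YanZhu2026

end
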